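import Summits.QuantumFields.YangMills.Theorems.AllWindowsColdBoxJaffardDecayCore

/-!
# Jaffard's theorem (inverse-closedness of polynomial off-diagonal decay) — part 2: the dyadic bootstrap

Toward LINE-18 stub K1 `DirKernelDipoleDecay` of crux `AllWindowsColdBox.BulkMidWindowSU2` (stmt-QuantumFields-24006), item K1-J of
the planner's STUB-PLAN-K1 (S. Jaffard 1990, Prop. 3, finite-index-set form with uniform constants).  Setting: a finite index type with a
pseudo-distance `d` of `D`-dimensional growth (volume `#{d(·,y) ≤ ρ} ≤ c_S (1+ρ)^D`, tails `Σ_{ρ ≤ d(z,y)} (1+d(z,y))^{−r} ≤ c_S(1+ρ)^{D−r}`,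
`0 < D < r`) and a symmetric `ℓ²`-contraction `R` (`‖Rv‖₂ ≤ q‖v‖₂`, `q < 1`) with `|R x y| (1 + d x y)^r ≤ c_R`.  This file runs the
bootstrap of part 1 along the dyadic powers and sums the Neumann series:
* `decay_pow_two_pow_le` — for every `k` there is `g ≥ 1` with `log g ≤ (1+θ)^k Γ − (log Θ)/θ` (`θ = D/(2r−D) < 1`, `Θ`, `Γ` explicit in
  the parameters) such that `|(R^{2^k}) x y| (1+d x y)^r ≤ q^{2^k} g/√c_S` and `col(R^{2^k}) ≤ 2√c_S q^{2^k} g^θ` — i.e. the weighted norms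
  of `R^{2^k}` are `≤ q^{2^k}·exp((1+θ)^k Γ)`, sub-exponentially off `q^{2^k}` since `1 + θ < 2`;
* `geom_sum_two_pow_succ`, `partialSum_le` — the dyadic partial sums `P_K = Σ_{n<2^K} Rⁿ = P_{K−1}(1 + R^{2^{K−1}})` have weighted
  sup-norm, column and row sums `≤ Π_{k<K} (1 + 2^r(col_k + dec_k))`;
* `isUnit_det_one_sub`, `inv_one_sub_le` — `1 − R` is invertible and the bounds pass to `(1−R)⁻¹ = lim_K P_K`
  (`(1−R)⁻¹ − P_K = R^{2^K}(1−R)⁻¹ → 0` entrywise);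
* `exists_sum_bound` — `Σ_k q^{2^k} exp((1+θ)^k Γ)` is bounded by a constant depending on `q, θ, Γ` only.
Pure Mathlib (via part 1); no definitions; standard axioms.

HONEST LABEL: helper lemmas toward one registered stub of a critic-passed line on the R2ξ″ RECORD-rung crux 24006; no stub, crux, rung
or summit is proved here; the Yang–Mills mass gap is NOT proved by this file.
-/

set_option autoImplicit false

open Finset Matrix

namespace Summit.QuantumFields.YangMills.Theorems.AllWindowsColdBox.Jaffard

variable {ι : Type*} [Fintype ι] [DecidableEq ι]

/-! ## The bootstrap along dyadic powers -/

/-- **Dyadic bootstrap.**  Under the hypotheses of `decay_pow_two_mul_le` and `|R x y| (1+d x y)^r ≤ c_R`, for every `k` there is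
`g ≥ 1` with `log g ≤ (1+θ)^k Γ − (log Θ)/θ` such that `|(R^{2^k}) x y| (1+d x y)^r ≤ q^{2^k} g/√c_S` and `col(R^{2^k}) ≤ 2√c_S q^{2^k} g^θ`,
where `θ = D/(2r−D)`, `Θ = max(1, 4·2^r √c_S)`, `Γ = log(max(1, √c_S c_R/q)) + (log Θ)/θ` (the exact solution of `g ↦ Θ g^{1+θ}`). -/
theorem decay_pow_two_pow_le (d : ι → ι → ℝ) {r D cS q cR : ℝ} (hD : 0 < D) (hDr : D < r) (hcS : 0 < cS)
    (hq : 0 < q)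
    (hd0 : ∀ x y, 0 ≤ d x y) (htri : ∀ x y z, d x y ≤ d x z + d z y)
    (hG1 : ∀ (y : ι) (ρ : ℝ), 0 ≤ ρ → ((Finset.univ.filter (fun z => d z y ≤ ρ)).card : ℝ) ≤ cS * (1 + ρ) ^ D)
    (hG2 : ∀ (y : ι) (ρ : ℝ), 0 ≤ ρ →
      ∑ z ∈ Finset.univ.filter (fun z => ρ ≤ d z y), ((1 + d z y) ^ r)⁻¹ ≤ cS * (1 + ρ) ^ (D - r))
    {R : Matrix ι ι ℝ} (hsymm : R.IsSymm) (hR : ∀ v : ι → ℝ, ∑ x, (R *ᵥ v) x ^ 2 ≤ q ^ 2 * ∑ x, v x ^ 2)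
    (hdecR : ∀ x y, |R x y| * (1 + d x y) ^ r ≤ cR) (k : ℕ) :
    ∃ g : ℝ, 1 ≤ g ∧
      Real.log g ≤ (1 + D / (2 * r - D)) ^ k *
          (Real.log (max 1 (Real.sqrt cS * cR / q)) +
            Real.log (max 1 (4 * 2 ^ r * Real.sqrt cS)) / (D / (2 * r - D))) -
        Real.log (max 1 (4 * 2 ^ r * Real.sqrt cS)) / (D / (2 * r - D)) ∧
      (∀ x y, |(R ^ (2 ^ k)) x y| * (1 + d x y) ^ r ≤ q ^ (2 ^ k) * g / Real.sqrt cS) ∧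
      (∀ y, ∑ z, |(R ^ (2 ^ k)) z y| ≤ 2 * Real.sqrt cS * q ^ (2 ^ k) * g ^ (D / (2 * r - D))) := by
  set θ : ℝ := D / (2 * r - D) with hθ
  set Θ : ℝ := max 1 (4 * 2 ^ r * Real.sqrt cS) with hΘ
  set G₀ : ℝ := max 1 (Real.sqrt cS * cR / q) with hG₀
  have hθ0 : 0 < θ := div_pos hD (by linarith)
  have hΘ1 : 1 ≤ Θ := le_max_left _ _
  have hsq0 : 0 < Real.sqrt cS := Real.sqrt_pos.2 hcS
  -- the column bound follows from the decay bound at the same level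
  have hcol_of : ∀ (k : ℕ) (g : ℝ), 1 ≤ g →
      (∀ x y, |(R ^ (2 ^ k)) x y| * (1 + d x y) ^ r ≤ q ^ (2 ^ k) * g / Real.sqrt cS) →
      (∀ y, ∑ z, |(R ^ (2 ^ k)) z y| ≤ 2 * Real.sqrt cS * q ^ (2 ^ k) * g ^ θ) ∧
      (∀ x y, |(R ^ (2 ^ (k + 1))) x y| * (1 + d x y) ^ r ≤ q ^ (2 ^ (k + 1)) * (Θ * g ^ (1 + θ)) / Real.sqrt cS) := by
    intro k g hg hdec
    have hg0 : 0 < g := lt_of_lt_of_le one_pos hg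
    have ha : 0 ≤ q ^ (2 ^ k) * g / Real.sqrt cS := by positivity
    have h := decay_pow_two_mul_le d hD hDr hcS hq hd0 htri hG1 hG2 hsymm hR (2 ^ k) ha hdec
    have hmax : max 1 (Real.sqrt cS * (q ^ (2 ^ k) * g / Real.sqrt cS) / q ^ (2 ^ k)) = g := by
      have : Real.sqrt cS * (q ^ (2 ^ k) * g / Real.sqrt cS) / q ^ (2 ^ k) = g := by
        field_simp
      rw [this, max_eq_right hg]
    rw [hmax] at h
    refine ⟨h.1, fun x y => ?_⟩
    have hpow : 2 ^ (k + 1) = 2 * 2 ^ k := by rw [pow_succ, mul_comm]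
    rw [hpow]
    calc |(R ^ (2 * 2 ^ k)) x y| * (1 + d x y) ^ r
          ≤ 4 * 2 ^ r * Real.sqrt cS * (q ^ (2 ^ k) * g / Real.sqrt cS) * q ^ (2 ^ k) * g ^ θ := h.2 x y
      _ = q ^ (2 * 2 ^ k) * ((4 * 2 ^ r * Real.sqrt cS) * g ^ (1 + θ)) / Real.sqrt cS := by
          rw [Real.rpow_add hg0, Real.rpow_one, two_mul, pow_add]
          field_simp
      _ ≤ q ^ (2 * 2 ^ k) * (Θ * g ^ (1 + θ)) / Real.sqrt cS := by
          have h1 : (4 * 2 ^ r * Real.sqrt cS) * g ^ (1 + θ) ≤ Θ * g ^ (1 + θ) :=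
            mul_le_mul_of_nonneg_right (le_max_right _ _) (Real.rpow_nonneg hg0.le _)
          have h2 : 0 ≤ q ^ (2 * 2 ^ k) := pow_nonneg hq.le _
          exact div_le_div_of_nonneg_right (mul_le_mul_of_nonneg_left h1 h2) hsq0.le
  -- induction on `k` for the decay bound with the sharp logarithmic invariant
  have main : ∀ k : ℕ, ∃ g : ℝ, 1 ≤ g ∧
      Real.log g ≤ (1 + θ) ^ k * (Real.log G₀ + Real.log Θ / θ) - Real.log Θ / θ ∧
      (∀ x y, |(R ^ (2 ^ k)) x y| * (1 + d x y) ^ r ≤ q ^ (2 ^ k) * g / Real.sqrt cS) := by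
    intro k
    induction k with
    | zero =>
        refine ⟨G₀, le_max_left _ _, by simp, fun x y => ?_⟩
        rw [pow_zero, pow_one, pow_one]
        calc |R x y| * (1 + d x y) ^ r ≤ cR := hdecR x y
          _ = q * (Real.sqrt cS * cR / q) / Real.sqrt cS := by field_simp
          _ ≤ q * G₀ / Real.sqrt cS :=
              div_le_div_of_nonneg_right (mul_le_mul_of_nonneg_left (le_max_right _ _) hq.le) hsq0.le
    | succ k ih =>
        obtain ⟨g, hg1, hlog, hdec⟩ := ih
        have hg0 : 0 < g := lt_of_lt_of_le one_pos hg1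
        refine ⟨Θ * g ^ (1 + θ), ?_, ?_, (hcol_of k g hg1 hdec).2⟩
        · exact one_le_mul_of_one_le_of_one_le hΘ1 (Real.one_le_rpow hg1 (by positivity))
        · rw [Real.log_mul (by positivity) (by positivity), Real.log_rpow hg0]
          have h1 : (1 + θ) * Real.log g ≤
              (1 + θ) * ((1 + θ) ^ k * (Real.log G₀ + Real.log Θ / θ) - Real.log Θ / θ) :=
            mul_le_mul_of_nonneg_left hlog (by positivity)
          have h2 : Real.log Θ + (1 + θ) * ((1 + θ) ^ k * (Real.log G₀ + Real.log Θ / θ) - Real.log Θ / θ) =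
              (1 + θ) ^ (k + 1) * (Real.log G₀ + Real.log Θ / θ) - Real.log Θ / θ := by
            field_simp
            ring
          linarith
  obtain ⟨g, hg1, hlog, hdec⟩ := main k
  exact ⟨g, hg1, hlog, hdec, (hcol_of k g hg1 hdec).1⟩

/-! ## Dyadic partial sums of the Neumann series, the limit, and the summability of the majorant -/

/-- `Σ_{n < 2^{K+1}} Rⁿ = P_K + P_K R^{2^K}` with `P_K = Σ_{n < 2^K} Rⁿ`. -/
theorem geom_sum_two_pow_succ (R : Matrix ι ι ℝ) (K : ℕ) :
    ∑ n ∈ Finset.range (2 ^ (K + 1)), R ^ n =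
      ∑ n ∈ Finset.range (2 ^ K), R ^ n + (∑ n ∈ Finset.range (2 ^ K), R ^ n) * R ^ (2 ^ K) := by
  rw [pow_succ, mul_two, Finset.sum_range_add, Finset.sum_mul]
  congr 1
  exact Finset.sum_congr rfl fun n _ => by rw [add_comm, pow_add]


/-- **Bounds for the dyadic partial sums** `P_K = Σ_{n<2^K} Rⁿ = Π_{k<K} (1 + R^{2^k})`: if `|(R^{2^k}) x y| (1+d x y)^r ≤ u_k` and
`col(R^{2^k}) ≤ c_k` for all `k`, then the weighted sup-norm, the column sums and the row sums of `P_K` are all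
`≤ Π_{k<K} (1 + 2^r (c_k + u_k))`. -/
theorem partialSum_le (d : ι → ι → ℝ) {r : ℝ} (hr : 0 ≤ r) (hd0 : ∀ x y, 0 ≤ d x y) (hdd : ∀ x, d x x = 0)
    (htri : ∀ x y z, d x y ≤ d x z + d z y) {R : Matrix ι ι ℝ} (hsymm : R.IsSymm) (u c : ℕ → ℝ)
    (hu : ∀ k, 0 ≤ u k) (hc : ∀ k, 0 ≤ c k)
    (hdec : ∀ k x y, |(R ^ (2 ^ k)) x y| * (1 + d x y) ^ r ≤ u k)
    (hcol : ∀ k y, ∑ z, |(R ^ (2 ^ k)) z y| ≤ c k) (K : ℕ) :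
    (∀ x y, |(∑ n ∈ Finset.range (2 ^ K), R ^ n) x y| * (1 + d x y) ^ r ≤
        ∏ k ∈ Finset.range K, (1 + 2 ^ r * (c k + u k))) ∧
    (∀ y, ∑ z, |(∑ n ∈ Finset.range (2 ^ K), R ^ n) z y| ≤ ∏ k ∈ Finset.range K, (1 + 2 ^ r * (c k + u k))) ∧
    (∀ x, ∑ z, |(∑ n ∈ Finset.range (2 ^ K), R ^ n) x z| ≤ ∏ k ∈ Finset.range K, (1 + 2 ^ r * (c k + u k))) := by
  have h2r : (1 : ℝ) ≤ 2 ^ r := Real.one_le_rpow (by norm_num) hr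
  induction K with
  | zero =>
      simp only [pow_zero, Finset.range_one, Finset.sum_singleton, Finset.range_zero, Finset.prod_empty]
      refine ⟨fun x y => ?_, fun y => ?_, fun x => ?_⟩
      · by_cases hxy : x = y
        · subst hxy; simp [hdd]
        · simp [Matrix.one_apply_ne hxy]
      · rw [Finset.sum_eq_single y (fun z _ hz => by simp [Matrix.one_apply_ne hz]) (fun h => absurd (Finset.mem_univ _) h)]
        simp
      · rw [Finset.sum_eq_single x (fun z _ hz => by simp [Matrix.one_apply_ne (Ne.symm hz)])
          (fun h => absurd (Finset.mem_univ _) h)]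
        simp
  | succ K ih =>
      obtain ⟨ihd, ihc, ihr⟩ := ih
      set E : ℝ := ∏ k ∈ Finset.range K, (1 + 2 ^ r * (c k + u k)) with hE
      have hE0 : 0 ≤ E := Finset.prod_nonneg fun k _ => by
        have := hu k; have := hc k; positivity
      have hprod : ∏ k ∈ Finset.range (K + 1), (1 + 2 ^ r * (c k + u k)) = E * (1 + 2 ^ r * (c K + u K)) :=
        Finset.prod_range_succ _ _
      rw [hprod, geom_sum_two_pow_succ R K]
      set P : Matrix ι ι ℝ := ∑ n ∈ Finset.range (2 ^ K), R ^ n with hP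
      have hrowN : ∀ x, ∑ z, |(R ^ (2 ^ K)) x z| ≤ c K := fun x => by
        rw [row_abs_pow_eq_col hsymm (2 ^ K) x]; exact hcol K x
      have hcK : c K ≤ 2 ^ r * (c K + u K) := by
        have := hu K; have := hc K; nlinarith
      refine ⟨fun x y => ?_, fun y => ?_, fun x => ?_⟩
      · have h1 := decay_mul_le d hr hd0 htri hE0 (hu K) ihd ihr (hdec K) (hcol K) x y
        have hw : 0 ≤ (1 + d x y) ^ r := Real.rpow_nonneg (by linarith [hd0 x y]) r
        calc |(P + P * R ^ (2 ^ K)) x y| * (1 + d x y) ^ r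
              ≤ (|P x y| + |(P * R ^ (2 ^ K)) x y|) * (1 + d x y) ^ r :=
              mul_le_mul_of_nonneg_right (by rw [Matrix.add_apply]; exact abs_add_le _ _) hw
          _ ≤ E + 2 ^ r * (E * c K + E * u K) := by rw [add_mul]; exact add_le_add (ihd x y) h1
          _ = E * (1 + 2 ^ r * (c K + u K)) := by ring
      · have h1 := col_mul_le hE0 ihc (hcol K) y
        calc ∑ z, |(P + P * R ^ (2 ^ K)) z y| ≤ ∑ z, (|P z y| + |(P * R ^ (2 ^ K)) z y|) :=
              Finset.sum_le_sum fun z _ => by rw [Matrix.add_apply]; exact abs_add_le _ _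
          _ ≤ E + E * c K := by rw [Finset.sum_add_distrib]; exact add_le_add (ihc y) h1
          _ ≤ E * (1 + 2 ^ r * (c K + u K)) := by
              rw [mul_add, mul_one]; exact add_le_add le_rfl (mul_le_mul_of_nonneg_left hcK hE0)
      · have h1 := row_mul_le (hc K) ihr hrowN x
        calc ∑ z, |(P + P * R ^ (2 ^ K)) x z| ≤ ∑ z, (|P x z| + |(P * R ^ (2 ^ K)) x z|) :=
              Finset.sum_le_sum fun z _ => by rw [Matrix.add_apply]; exact abs_add_le _ _
          _ ≤ E + E * c K := by rw [Finset.sum_add_distrib]; exact add_le_add (ihr x) h1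
          _ ≤ E * (1 + 2 ^ r * (c K + u K)) := by
              rw [mul_add, mul_one]; exact add_le_add le_rfl (mul_le_mul_of_nonneg_left hcK hE0)

/-- An `ℓ²`-contraction `R` (`q < 1`) has `1 − R` invertible. -/
theorem isUnit_det_one_sub {R : Matrix ι ι ℝ} {q : ℝ} (hq : 0 ≤ q) (hq1 : q < 1)
    (hR : ∀ v : ι → ℝ, ∑ x, (R *ᵥ v) x ^ 2 ≤ q ^ 2 * ∑ x, v x ^ 2) : IsUnit (1 - R).det := by
  rw [← Matrix.isUnit_iff_isUnit_det, ← Matrix.mulVec_injective_iff_isUnit]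
  intro v w hvw
  have h0 : (1 - R) *ᵥ (v - w) = 0 := by rw [Matrix.mulVec_sub, hvw, sub_self]
  have h1 : R *ᵥ (v - w) = v - w := by
    rw [Matrix.sub_mulVec, Matrix.one_mulVec, sub_eq_zero] at h0
    exact h0.symm
  have h2 : ∑ x, (v - w) x ^ 2 ≤ q ^ 2 * ∑ x, (v - w) x ^ 2 := by simpa [h1] using hR (v - w)
  have hs0 : 0 ≤ ∑ x, (v - w) x ^ 2 := Finset.sum_nonneg fun x _ => sq_nonneg _
  have hq2 : q ^ 2 < 1 := by nlinarith
  have hs : ∑ x, (v - w) x ^ 2 = 0 := by nlinarith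
  have hall := (Finset.sum_eq_zero_iff_of_nonneg fun x _ => sq_nonneg ((v - w) x)).1 hs
  funext x
  have := hall x (Finset.mem_univ x)
  rw [sq_eq_zero_iff, Pi.sub_apply, sub_eq_zero] at this
  exact this

/-- **Passage to the limit.**  If `R` is a symmetric `ℓ²`-contraction (`q < 1`) and every dyadic partial sum `P_K = Σ_{n<2^K} Rⁿ`
has weighted sup-norm and column sums `≤ T`, then so does `(1 − R)⁻¹ = lim P_K` (`(1−R)⁻¹ − P_K = R^{2^K}(1−R)⁻¹` has entries
`≤ q^{2^K}·‖column‖₂`). -/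
theorem inv_one_sub_le (d : ι → ι → ℝ) {r q T : ℝ} (hq : 0 ≤ q) (hq1 : q < 1) (hd0 : ∀ x y, 0 ≤ d x y)
    {R : Matrix ι ι ℝ} (hsymm : R.IsSymm) (hR : ∀ v : ι → ℝ, ∑ x, (R *ᵥ v) x ^ 2 ≤ q ^ 2 * ∑ x, v x ^ 2)
    (hP : ∀ K : ℕ, (∀ x y, |(∑ n ∈ Finset.range (2 ^ K), R ^ n) x y| * (1 + d x y) ^ r ≤ T) ∧
      (∀ y, ∑ z, |(∑ n ∈ Finset.range (2 ^ K), R ^ n) z y| ≤ T)) :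
    (∀ x y, |((1 - R)⁻¹) x y| * (1 + d x y) ^ r ≤ T) ∧ (∀ y, ∑ z, |((1 - R)⁻¹) z y| ≤ T) := by
  have hdet := isUnit_det_one_sub hq hq1 hR
  set M : Matrix ι ι ℝ := (1 - R)⁻¹ with hM
  -- `(1 - R)⁻¹ = P_K + R^{2^K} (1 - R)⁻¹`
  have hsplit : ∀ K : ℕ, M = ∑ n ∈ Finset.range (2 ^ K), R ^ n + R ^ (2 ^ K) * M := by
    intro K
    have h1 : (∑ n ∈ Finset.range (2 ^ K), R ^ n) * (1 - R) = 1 - R ^ (2 ^ K) := geom_sum_mul_neg R (2 ^ K)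
    have h2 : (∑ n ∈ Finset.range (2 ^ K), R ^ n) = (1 - R ^ (2 ^ K)) * M := by
      rw [← h1, hM, Matrix.mul_nonsing_inv_cancel_right _ _ hdet]
    rw [h2, sub_mul, one_mul, sub_add_cancel]
  -- the remainder entries
  set m : ι → ℝ := fun y => Real.sqrt (∑ z, M z y ^ 2) with hm
  have hm0 : ∀ y, 0 ≤ m y := fun y => Real.sqrt_nonneg _
  have hrem : ∀ (K : ℕ) (x y : ι), |(R ^ (2 ^ K) * M) x y| ≤ q ^ (2 ^ K) * m y := by
    intro K x y
    rw [Matrix.mul_apply]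
    have hcs := Finset.sum_mul_sq_le_sq_mul_sq Finset.univ (fun z => (R ^ (2 ^ K)) x z) (fun z => M z y)
    have hrow := sq_row_pow_le hq hsymm hR (2 ^ K) x
    have h1 : (∑ z, (R ^ (2 ^ K)) x z * M z y) ^ 2 ≤ (q ^ (2 ^ K) * m y) ^ 2 := by
      rw [mul_pow, hm, Real.sq_sqrt (Finset.sum_nonneg fun z _ => sq_nonneg _)]
      exact hcs.trans (mul_le_mul_of_nonneg_right hrow (Finset.sum_nonneg fun z _ => sq_nonneg _))
    exact abs_le_of_sq_le_sq' h1 (mul_nonneg (pow_nonneg hq _) (hm0 y)) |>.2 |> fun h =>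
      abs_le.2 ⟨(abs_le_of_sq_le_sq' h1 (mul_nonneg (pow_nonneg hq _) (hm0 y))).1, h⟩
  -- `q^{2^K} → 0`
  have hsmall : ∀ ε : ℝ, 0 < ε → ∀ c : ℝ, 0 ≤ c → ∃ K : ℕ, q ^ (2 ^ K) * c < ε := by
    intro ε hε c hc
    obtain ⟨K, hK⟩ := exists_pow_lt_of_lt_one (show 0 < ε / (c + 1) by positivity) hq1
    refine ⟨K, ?_⟩
    have h1 : q ^ (2 ^ K) ≤ q ^ K := pow_le_pow_of_le_one hq hq1.le (Nat.lt_two_pow_self).le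
    calc q ^ (2 ^ K) * c ≤ q ^ K * c := mul_le_mul_of_nonneg_right h1 hc
      _ ≤ q ^ K * (c + 1) := mul_le_mul_of_nonneg_left (by linarith) (pow_nonneg hq _)
      _ < ε / (c + 1) * (c + 1) := mul_lt_mul_of_pos_right hK (by linarith)
      _ = ε := div_mul_cancel₀ ε (by linarith)
  refine ⟨fun x y => ?_, fun y => ?_⟩
  · have hw : 0 ≤ (1 + d x y) ^ r := Real.rpow_nonneg (by linarith [hd0 x y]) r
    refine le_of_forall_pos_le_add fun ε hε => ?_
    obtain ⟨K, hK⟩ := hsmall ε hε (m y * (1 + d x y) ^ r) (mul_nonneg (hm0 y) hw)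
    calc |M x y| * (1 + d x y) ^ r
          = |(∑ n ∈ Finset.range (2 ^ K), R ^ n + R ^ (2 ^ K) * M) x y| * (1 + d x y) ^ r := by rw [← hsplit K]
      _ ≤ (|(∑ n ∈ Finset.range (2 ^ K), R ^ n) x y| + |(R ^ (2 ^ K) * M) x y|) * (1 + d x y) ^ r :=
          mul_le_mul_of_nonneg_right (by rw [Matrix.add_apply]; exact abs_add_le _ _) hw
      _ ≤ T + q ^ (2 ^ K) * m y * (1 + d x y) ^ r := by
          rw [add_mul]; exact add_le_add ((hP K).1 x y) (mul_le_mul_of_nonneg_right (hrem K x y) hw)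
      _ ≤ T + ε := by rw [mul_assoc]; exact add_le_add le_rfl hK.le
  · refine le_of_forall_pos_le_add fun ε hε => ?_
    obtain ⟨K, hK⟩ := hsmall ε hε ((Fintype.card ι : ℝ) * m y) (mul_nonneg (Nat.cast_nonneg _) (hm0 y))
    calc ∑ z, |M z y| = ∑ z, |(∑ n ∈ Finset.range (2 ^ K), R ^ n + R ^ (2 ^ K) * M) z y| := by rw [← hsplit K]
      _ ≤ ∑ z, (|(∑ n ∈ Finset.range (2 ^ K), R ^ n) z y| + |(R ^ (2 ^ K) * M) z y|) :=
          Finset.sum_le_sum fun z _ => by rw [Matrix.add_apply]; exact abs_add_le _ _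
      _ ≤ T + ∑ z, q ^ (2 ^ K) * m y := by
          rw [Finset.sum_add_distrib]; exact add_le_add ((hP K).2 y) (Finset.sum_le_sum fun z _ => hrem K z y)
      _ = T + q ^ (2 ^ K) * ((Fintype.card ι : ℝ) * m y) := by
          rw [Finset.sum_const, nsmul_eq_mul, Finset.card_univ]; ring
      _ ≤ T + ε := add_le_add le_rfl hK.le

/-- **Summability of the bootstrap majorant**: `Σ_{k<K} q^{2^k} exp((1+θ)^k Γ)` is bounded uniformly in `K` (`0 < q < 1`,
`0 ≤ θ < 1`, `Γ ≥ 0`): `(1+θ)^k = (2ρ)^k` with `ρ < 1`, so the exponent `2^k (ρ^k Γ + log q)` is eventually `≤ −2^k |log q|/2`. -/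
theorem exists_sum_bound (Γ θ q : ℝ) (hΓ : 0 ≤ Γ) (hθ0 : 0 ≤ θ) (hθ1 : θ < 1) (hq : 0 < q) (hq1 : q < 1) :
    ∃ S : ℝ, ∀ K : ℕ, ∑ k ∈ Finset.range K, q ^ (2 ^ k) * Real.exp ((1 + θ) ^ k * Γ) ≤ S := by
  set ρ : ℝ := (1 + θ) / 2 with hρ
  have hρ0 : 0 < ρ := by positivity
  have hρ1 : ρ < 1 := by rw [hρ]; linarith
  set L : ℝ := -Real.log q with hL
  have hL0 : 0 < L := by rw [hL]; exact neg_pos.2 (Real.log_neg hq hq1)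
  obtain ⟨k₀, hk₀⟩ := exists_pow_lt_of_lt_one (show 0 < L / (2 * (Γ + 1)) by positivity) hρ1
  set x : ℝ := Real.exp (-(L / 2)) with hx
  have hx0 : 0 < x := Real.exp_pos _
  have hx1 : x < 1 := by
    rw [hx, ← Real.exp_zero]; exact Real.exp_lt_exp.2 (by linarith)
  refine ⟨(k₀ : ℝ) * Real.exp ((1 + θ) ^ k₀ * Γ) + x * (1 - x)⁻¹, fun K => ?_⟩
  -- early terms
  have hearly : ∀ k, k < k₀ → q ^ (2 ^ k) * Real.exp ((1 + θ) ^ k * Γ) ≤ Real.exp ((1 + θ) ^ k₀ * Γ) := by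
    intro k hk
    have h1 : q ^ (2 ^ k) ≤ 1 := pow_le_one₀ hq.le hq1.le
    have h2 : (1 + θ) ^ k * Γ ≤ (1 + θ) ^ k₀ * Γ :=
      mul_le_mul_of_nonneg_right (pow_le_pow_right₀ (by linarith) hk.le) hΓ
    calc q ^ (2 ^ k) * Real.exp ((1 + θ) ^ k * Γ) ≤ 1 * Real.exp ((1 + θ) ^ k₀ * Γ) :=
          mul_le_mul h1 (Real.exp_le_exp.2 h2) (Real.exp_pos _).le zero_le_one
      _ = Real.exp ((1 + θ) ^ k₀ * Γ) := one_mul _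
  -- late terms
  have hlate : ∀ k, k₀ ≤ k → q ^ (2 ^ k) * Real.exp ((1 + θ) ^ k * Γ) ≤ x ^ (k + 1) := by
    intro k hk
    have hq' : q ^ (2 ^ k) = Real.exp (((2 : ℝ) ^ k) * Real.log q) := by
      rw [← Real.rpow_natCast, Real.rpow_def_of_pos hq]
      congr 1
      push_cast
      ring
    have h1θ : (1 + θ) ^ k = (2 : ℝ) ^ k * ρ ^ k := by rw [← mul_pow]; congr 1; rw [hρ]; ring
    rw [hq', ← Real.exp_add, hx, ← Real.exp_nat_mul, Real.exp_le_exp, h1θ]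
    have hρk : ρ ^ k * (Γ + 1) ≤ L / 2 := by
      have h1 : ρ ^ k ≤ ρ ^ k₀ := pow_le_pow_of_le_one hρ0.le hρ1.le hk
      have h2 : ρ ^ k₀ * (Γ + 1) ≤ L / (2 * (Γ + 1)) * (Γ + 1) := mul_le_mul_of_nonneg_right hk₀.le (by linarith)
      have h3 : L / (2 * (Γ + 1)) * (Γ + 1) = L / 2 := by field_simp
      nlinarith [mul_le_mul_of_nonneg_right h1 (show (0 : ℝ) ≤ Γ + 1 by linarith)]
    have h2k : ((k + 1 : ℕ) : ℝ) ≤ (2 : ℝ) ^ k := by exact_mod_cast Nat.lt_two_pow_self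
    have h2k0 : (0 : ℝ) ≤ (2 : ℝ) ^ k := by positivity
    have hρk0 : 0 ≤ ρ ^ k := pow_nonneg hρ0.le k
    have hlq : Real.log q = -L := by rw [hL, neg_neg]
    rw [hlq]
    nlinarith [mul_le_mul_of_nonneg_left hρk h2k0, mul_nonneg h2k0 (mul_nonneg hρk0 hΓ)]
  -- split the sum at `k₀`
  have hsum_late : ∑ k ∈ (Finset.range K).filter (fun k => k₀ ≤ k), q ^ (2 ^ k) * Real.exp ((1 + θ) ^ k * Γ) ≤
      x * (1 - x)⁻¹ := by
    calc ∑ k ∈ (Finset.range K).filter (fun k => k₀ ≤ k), q ^ (2 ^ k) * Real.exp ((1 + θ) ^ k * Γ)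
          ≤ ∑ k ∈ (Finset.range K).filter (fun k => k₀ ≤ k), x ^ (k + 1) :=
          Finset.sum_le_sum fun k hk => hlate k (Finset.mem_filter.1 hk).2
      _ ≤ ∑ k ∈ Finset.range K, x ^ (k + 1) :=
          Finset.sum_le_sum_of_subset_of_nonneg (Finset.filter_subset _ _) fun k _ _ => pow_nonneg hx0.le _
      _ = x * ∑ k ∈ Finset.range K, x ^ k := by
          rw [Finset.mul_sum]; exact Finset.sum_congr rfl fun k _ => by ring
      _ ≤ x * (1 - x)⁻¹ := by
          refine mul_le_mul_of_nonneg_left ?_ hx0.le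
          have hs := summable_geometric_of_lt_one hx0.le hx1
          calc ∑ k ∈ Finset.range K, x ^ k ≤ ∑' k, x ^ k :=
                hs.sum_le_tsum (Finset.range K) fun k _ => pow_nonneg hx0.le k
            _ = (1 - x)⁻¹ := tsum_geometric_of_lt_one hx0.le hx1
  have hsum_early : ∑ k ∈ (Finset.range K).filter (fun k => ¬ k₀ ≤ k), q ^ (2 ^ k) * Real.exp ((1 + θ) ^ k * Γ) ≤
      (k₀ : ℝ) * Real.exp ((1 + θ) ^ k₀ * Γ) := by
    calc ∑ k ∈ (Finset.range K).filter (fun k => ¬ k₀ ≤ k), q ^ (2 ^ k) * Real.exp ((1 + θ) ^ k * Γ)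
          ≤ ∑ k ∈ (Finset.range K).filter (fun k => ¬ k₀ ≤ k), Real.exp ((1 + θ) ^ k₀ * Γ) :=
          Finset.sum_le_sum fun k hk => hearly k (not_le.1 (Finset.mem_filter.1 hk).2)
      _ ≤ ∑ k ∈ Finset.range k₀, Real.exp ((1 + θ) ^ k₀ * Γ) := by
          refine Finset.sum_le_sum_of_subset_of_nonneg (fun k hk => ?_) fun k _ _ => (Real.exp_pos _).le
          exact Finset.mem_range.2 (not_le.1 (Finset.mem_filter.1 hk).2)
      _ = (k₀ : ℝ) * Real.exp ((1 + θ) ^ k₀ * Γ) := by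
          rw [Finset.sum_const, Finset.card_range, nsmul_eq_mul]
  rw [← Finset.sum_filter_add_sum_filter_not (Finset.range K) (fun k => k₀ ≤ k)]
  linarith

end Summit.QuantumFields.YangMills.Theorems.AllWindowsColdBox.Jaffard
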